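import Summits.CriticalPhenomena.PercolationContinuityZ3.Theorems.PercNearOneGluingNoHeavyPcintVdBEStepDomination
import HarnessLib

/-!
# PCINT lane, king route, K1 step (3b): per-state domination, the root step (`c = o`)

Cell `prim-pcint`, seat `prim-pcint-1` (gen 10); memo `run/shared/lean/prim/pcint/KING-ROUTE.md` §K1 (3).

The analogue of `…PcintVdBEStepDomination.lean` for a step whose selected site `b₂` was examined by the ROOT `c = o`
(root rule `ε(o) = (1,1)`): the fibre condition of `StepCtx.fib_mixG_iff_root` has the factor `[u c = (1,1)]` in place of
the `d`-factor and three brother positions (the other neighbours of `o`); the table is `VdBELocal.dominance_checkRoot11`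
at `b2 = pos b₂ - pos o ∈ nbrs 0` (positions relative to `o`).  Result: `StepCtx.inner_dominance_root`.
-/

namespace Summit.CriticalPhenomena.PercolationContinuityZ3.Theorems.Pcint

namespace VdBEMarkov

open Finset AdaptDom ClusterExpl VdBEProcess VdBELocal Literature.Probability.LatticeModels

variable {Λ : Finset (Site 2)} {enc : ↥Λ → ℕ} {o : ↥Λ}

/-- The children list of the root table is the translate of the children offsets. -/
theorem childrenR_eq_map {cp : Pos} (hcp : cp ∈ nbrs (0, 0)) :
    ((nbrs (-cp)).filter fun a => a ≠ (0, 0)) = (((nbrs (0, 0)).filter fun a => a ≠ cp)).map fun δ => -cp + δ := by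
  simp only [nbrs, List.mem_cons, List.mem_nil_iff, or_false, zero_add, zero_sub] at hcp
  rcases hcp with rfl | rfl | rfl | rfl <;> decide

namespace StepCtx

variable (X : StepCtx enc o)

/-! ### The root step: positions relative to `c = o` -/

/-- The offset of `b₂` from `c`. -/
def b2p : Pos := pos X.b₂.1 - pos X.c.1

/-- `b2p = -cp`. -/
theorem b2p_eq : X.b2p = -X.cp := by simp [b2p, cp]

/-- `b2p` is a unit offset. -/
theorem b2p_mem : X.b2p ∈ nbrs (0, 0) := sub_mem_nbrs0_of_adj X.adj_c_b₂

/-- The children offset list, written as in the table. -/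
theorem chL_eq' : ((nbrs (0, 0)).filter fun a => a ≠ X.cp) = [X.δ 0, X.δ 1, X.δ 2] := X.chL_eq

/-- The children list of the root table. -/
theorem chR_eq : ((nbrs X.b2p).filter fun a => a ≠ (0, 0)) = [X.b2p + X.δ 0, X.b2p + X.δ 1, X.b2p + X.δ 2] := by
  rw [X.b2p_eq, childrenR_eq_map X.cp_mem, X.chL_eq']; simp

/-- The root factor `[γ = (1,1)]`. -/
noncomputable def D11 (γ : PState) : ℝ := if γ = (true, true) then 1 else 0

/-- **The fibre condition of `fib_mixG_iff_root`** (case `c = o`), as a predicate (of this file, not a cited fact). -/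
def PsiR (u w : ↥Λ → PState) : Prop :=
  etaB X.b₂.1 X.c.1 (u X.b₂) (u X.c) = true ∧ u X.c = (true, true) ∧
    (∀ b ∈ X.B, X.σ b = some false → etaB b.1 X.c.1 (u b) (u X.c) = false) ∧
    (∀ b ∈ X.B, b ≠ X.b₂ → X.σ b = some true → etaB b.1 X.c.1 (w b) (u X.c) = true)

/-- The fibre factorisation with `PsiR`. -/
theorem fib_mixG_iff_root' (hco : X.c = o) (u w : ↥Λ → PState) :
    Fib enc o X.n X.σ (mixG X.W₀ u w) ↔ X.FibRest w ∧ X.PsiR u w :=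
  X.fib_mixG_iff_root hco u w

/-- **The indicator of `PsiR` is the product of the four factors.** -/
theorem ind_PsiR (u w : ↥Λ → PState) [Decidable (X.PsiR u w)] :
    (if X.PsiR u w then (1 : ℝ) else 0) =
      X.Aα (u X.b₂) (u X.c) * D11 (u X.c) * X.Sc w (u X.c) * ∏ b ∈ X.Bf, X.Fb b (u b) (u X.c) := by
  by_cases hΨ : X.PsiR u w
  · rw [if_pos hΨ]
    obtain ⟨h1, h2, h3, h4⟩ := hΨ
    rw [Aα, if_pos h1, D11, if_pos h2, Sc, if_pos h4, Finset.prod_eq_one (fun b hb => ?_)]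
    · ring
    · simp only [Fb]; rw [if_pos (h3 b (X.mem_Bf hb).1 (X.mem_Bf hb).2.1)]
  · rw [if_neg hΨ]
    unfold PsiR at hΨ
    by_cases h1 : etaB X.b₂.1 X.c.1 (u X.b₂) (u X.c) = true
    · by_cases h2 : u X.c = (true, true)
      · by_cases h4 : (∀ b ∈ X.B, b ≠ X.b₂ → X.σ b = some true → etaB b.1 X.c.1 (w b) (u X.c) = true)
        · have h3 : ¬ (∀ b ∈ X.B, X.σ b = some false → etaB b.1 X.c.1 (u b) (u X.c) = false) :=
            fun h3 => hΨ ⟨h1, h2, h3, h4⟩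
          push Not at h3
          obtain ⟨b, hbB, hσ, hne⟩ := h3
          have hbf : b ∈ X.Bf := mem_filter.2 ⟨hbB, hσ⟩
          rw [Finset.prod_eq_zero hbf (by simp only [Fb]; rw [if_neg hne])]
          ring
        · rw [Sc, if_neg h4]; ring
      · rw [D11, if_neg h2]; ring
    · rw [Aα, if_neg h1]; ring

/-! ### The three brother positions of the root -/

/-- The `i`-th brother offset from `c` (the neighbours of `c` other than `b₂`), in the table's order. -/
def πR (i : ℕ) : Pos := ((nbrs (0, 0)).filter fun b => b ≠ X.b2p).getD i (0, 0)

/-- The brother offset list is `[πR 0, πR 1, πR 2]`. -/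
theorem brLR_eq : ((nbrs (0, 0)).filter fun b => b ≠ X.b2p) = [X.πR 0, X.πR 1, X.πR 2] :=
  list_eq_three (children_spec X.b2p_mem).1

/-- The brother offsets are unit offsets other than `b2p`. -/
theorem πR_spec {i : ℕ} (hi : i < 3) : X.πR i ∈ nbrs (0, 0) ∧ X.πR i ≠ X.b2p := by
  have h : X.πR i ∈ ((nbrs (0, 0)).filter fun b => b ≠ X.b2p) := by
    rw [X.brLR_eq]; interval_cases i <;> simp
  rw [List.mem_filter] at h; simpa using h

/-- The brother offsets are pairwise distinct. -/
theorem πR_ne : X.πR 0 ≠ X.πR 1 ∧ X.πR 0 ≠ X.πR 2 ∧ X.πR 1 ≠ X.πR 2 := by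
  have h := (children_spec X.b2p_mem).2
  rw [X.brLR_eq] at h
  exact ne_of_nodup_three h

/-- The optional site at the `i`-th brother position of the root. -/
noncomputable def obR (i : ℕ) : Option ↥Λ := siteAt Λ (pos X.c.1 + X.πR i)

/-- The relative position of a brother site. -/
theorem obR_sub (i : ℕ) : ∀ b, X.obR i = some b → pos b.1 - pos X.c.1 = X.πR i :=
  fun _ h => by rw [siteAt_eq_some_iff.1 h, add_sub_cancel_left]

/-- A brother site is not `b₂`. -/
theorem obR_ne_b₂ {i : ℕ} (hi : i < 3) : ∀ b, X.obR i = some b → b ≠ X.b₂ := fun b h hb => by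
  have := X.obR_sub i b h
  rw [hb] at this
  exact (X.πR_spec hi).2 this.symm

/-- The brother sites are distinct. -/
theorem obR_distinct : (∀ v, X.obR 0 = some v → X.obR 1 ≠ some v) ∧ (∀ v, X.obR 0 = some v → X.obR 2 ≠ some v) ∧
    (∀ v, X.obR 1 = some v → X.obR 2 ≠ some v) := by
  obtain ⟨h01, h02, h12⟩ := X.πR_ne
  exact ⟨fun v hv => siteAt_ne_of_ne (fun h => h01 (add_left_cancel h)) v hv,
    fun v hv => siteAt_ne_of_ne (fun h => h02 (add_left_cancel h)) v hv,
    fun v hv => siteAt_ne_of_ne (fun h => h12 (add_left_cancel h)) v hv⟩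

/-- **Every site examined by the root, other than `b₂`, sits at a brother position.** -/
theorem obR_cover {b : ↥Λ} (hb : b ∈ X.B) (hne : b ≠ X.b₂) :
    X.obR 0 = some b ∨ X.obR 1 = some b ∨ X.obR 2 = some b := by
  have hρ : pos b.1 - pos X.c.1 ∈ ((nbrs (0, 0)).filter fun b => b ≠ X.b2p) := by
    rw [List.mem_filter]
    refine ⟨sub_mem_nbrs0_of_adj (X.mem_B hb).2, ?_⟩
    simp only [ne_eq, decide_eq_true_eq]
    exact fun h => hne (Subtype.ext (pos_injective (sub_left_injective h)))
  rw [X.brLR_eq] at hρ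
  simp only [List.mem_cons, List.mem_nil_iff, or_false] at hρ
  have key : ∀ i, pos b.1 - pos X.c.1 = X.πR i → X.obR i = some b := fun i hi => by
    unfold obR; rw [← hi, add_sub_cancel]; exact siteAt_pos b
  rcases hρ with h | h | h
  · exact Or.inl (key 0 h)
  · exact Or.inr (Or.inl (key 1 h))
  · exact Or.inr (Or.inr (key 2 h))

/-- The normalisation of the three slot factors. -/
noncomputable def ZR (w : ↥Λ → PState) : ℝ :=
  normS (X.slotOf w (X.obR 0)) * normS (X.slotOf w (X.obR 1)) * normS (X.slotOf w (X.obR 2))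

/-- `ZR > 0`. -/
theorem ZR_pos (w : ↥Λ → PState) : 0 < X.ZR w := mul_pos (mul_pos (normS_pos _) (normS_pos _)) (normS_pos _)

/-- The successful-brother indicator regrouped over the three brother positions. -/
theorem Sc_eq_root (w : ↥Λ → PState) (γ : PState) :
    X.Sc w γ = X.optP w γ (X.obR 0) * (X.optP w γ (X.obR 1) * X.optP w γ (X.obR 2)) := by
  unfold Sc optP
  rw [← ind_and, ← ind_and]
  have h : (∀ b ∈ X.B, b ≠ X.b₂ → X.σ b = some true → etaB b.1 X.c.1 (w b) γ = true) ↔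
      (∀ b ∈ X.Bs, etaB b.1 X.c.1 (w b) γ = true) := by
    simp only [Bs, mem_filter, and_imp]
  exact if_congr (h.trans (forall_iff_opt_three _ (X.obR 0) (X.obR 1) (X.obR 2)
    (fun b hb => X.obR_cover (mem_filter.1 hb).1 (mem_filter.1 hb).2.1))) rfl rfl

/-- **The brother factors are the root table's slot factors** (up to the normalisation `ZR`). -/
theorem sf_prod_eq_root (w : ↥Λ → PState) (γ : PState) :
    (slotFactor (0, 0) (X.πR 0) γ (X.slotOf w (X.obR 0)) : ℝ) * (slotFactor (0, 0) (X.πR 1) γ (X.slotOf w (X.obR 1)) : ℝ)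
      * (slotFactor (0, 0) (X.πR 2) γ (X.slotOf w (X.obR 2)) : ℝ) = X.ZR w * (X.Sc w γ * ∏ b ∈ X.Bf, X.fb γ b) := by
  obtain ⟨h01, h02, h12⟩ := X.obR_distinct
  rw [X.slot_cast w γ (pos_sub_self X.c.1) (X.obR_sub 0) (X.obR_ne_b₂ (by norm_num)),
    X.slot_cast w γ (pos_sub_self X.c.1) (X.obR_sub 1) (X.obR_ne_b₂ (by norm_num)),
    X.slot_cast w γ (pos_sub_self X.c.1) (X.obR_sub 2) (X.obR_ne_b₂ (by norm_num)),
    prod_eq_optF_three (X.fb γ) (X.obR 0) (X.obR 1) (X.obR 2) h01 h02 h12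
      (fun b hb => X.obR_cover (X.mem_Bf hb).1 (X.mem_Bf hb).2.2.1),
    X.Sc_eq_root w γ]
  unfold ZR; ring

/-! ### The per-state domination inequality, root step -/

/-- The weight of the pair `(α, γ)` of states of `(b₂, c)` in the fibre of a root step, given `w`. -/
noncomputable def ΦR (w : ↥Λ → PState) (α γ : PState) : ℝ :=
  mP α * mP γ * X.Aα α γ * D11 γ * X.Sc w γ * ∏ b ∈ X.Bf, X.fb γ b

/-- `cpsG` at the translated children positions of the root table is `cps`. -/
theorem cpsG_b2p (j : ℕ) (α : PState) (b : Bool) : cpsG (X.b2p + X.δ j) X.b2p α b = X.cps j α b := by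
  unfold cps cpsG
  refine Finset.sum_congr rfl fun s _ => ?_
  rw [← eta_sub (X.b2p + X.δ j) X.b2p X.b2p, add_sub_cancel_left, sub_self]
  rfl

/-- **The root table's law vector, unfolded.** -/
theorem lawN_cast_root (w : ↥Λ → PState) (y : Bool × Bool × Bool) :
    (lawN X.b2p (0, 0) (fun γ => if γ = (true, true) then 1 else 0)
        ((nbrs (0, 0)).filter fun b => b ≠ X.b2p) [X.slotOf w (X.obR 0), X.slotOf w (X.obR 1), X.slotOf w (X.obR 2)]
        ((nbrs X.b2p).filter fun a => a ≠ (0, 0)) (toL y) : ℝ) =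
      10 ^ 30 * X.ZR w * ∑ α, ∑ γ, X.ΦR w α γ * (X.cps 0 α y.1 * X.cps 1 α y.2.1 * X.cps 2 α y.2.2) := by
  rw [X.brLR_eq, X.chR_eq]
  simp only [toL]
  rw [lawN_three_three]
  push_cast
  rw [Finset.mul_sum]
  refine Finset.sum_congr rfl fun α _ => ?_
  rw [Finset.mul_sum]
  refine Finset.sum_congr rfl fun γ _ => ?_
  have hA : (if eta X.b2p (0, 0) α γ then (1 : ℝ) else 0) = X.Aα α γ := by
    simp only [Aα, etaB_eq_eta_sub X.b₂.1 X.c.1 (pos X.c.1), pos_sub_self]; rfl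
  have hD : (if γ = (true, true) then (1 : ℝ) else 0) = D11 γ := rfl
  rw [priorN_cast, priorN_cast, hA, hD, X.sf_prod_eq_root w γ, childProb_cast, childProb_cast, childProb_cast,
    X.cpsG_b2p, X.cpsG_b2p, X.cpsG_b2p]
  simp only [ΦR]
  ring

/-- **Per-state domination, root step.** -/
theorem inner_dominance_root {g : (↥Λ → Bool) → ℝ} (hg : StepTest X.C g) (w : ↥Λ → PState) :
    (∑ u, pw X.mPV u * (X.Aα (u X.b₂) (u X.c) * D11 (u X.c) * X.Sc w (u X.c) *
        ∏ b ∈ X.Bf, X.Fb b (u b) (u X.c))) * (∑ ω : ↥Λ → Bool, wt (556 / 1000) ω * g ω) ≤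
      ∑ u, pw X.mPV u * (X.Aα (u X.b₂) (u X.c) * D11 (u X.c) * X.Sc w (u X.c) *
        (∏ b ∈ X.Bf, X.Fb b (u b) (u X.c)) * X.K g u) := by
  obtain ⟨h01, h02, h12⟩ := X.oc_distinct
  have hb₂ : X.b₂ ∉ X.Bf := fun h => (X.mem_Bf h).2.2.1 rfl
  have hc : X.c ∉ X.Bf := fun h => (X.mem_Bf h).2.2.2.1 rfl
  have eM : ∑ u, pw X.mPV u * (X.Aα (u X.b₂) (u X.c) * D11 (u X.c) * X.Sc w (u X.c) *
      ∏ b ∈ X.Bf, X.Fb b (u b) (u X.c)) = ∑ α, ∑ γ, X.ΦR w α γ := by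
    have h := inner_sum_eq X.mPV X.mPV_sum X.b₂ X.c X.b₂_ne_c.symm X.Bf hb₂ hc (X.oc 0) (X.oc 1) (X.oc 2) h01 h02 h12
      X.oc_hoW X.Aα D11 (X.Sc w) X.Fb X.φ (fun _ _ _ => (1 : ℝ))
    simp only [mul_one] at h
    rw [h]
    refine Finset.sum_congr rfl fun α _ => Finset.sum_congr rfl fun γ _ => ?_
    rw [X.sum_lawB_prod α, mul_one]
    rfl
  have eR : ∑ u, pw X.mPV u * (X.Aα (u X.b₂) (u X.c) * D11 (u X.c) * X.Sc w (u X.c) *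
      (∏ b ∈ X.Bf, X.Fb b (u b) (u X.c)) * X.K g u) =
      ∑ α, ∑ γ, X.ΦR w α γ * ∑ y0, ∑ y1, ∑ y2, X.cps 0 α y0 * X.cps 1 α y1 * X.cps 2 α y2 * X.Gt g y0 y1 y2 := by
    have e1 : ∀ u, pw X.mPV u * (X.Aα (u X.b₂) (u X.c) * D11 (u X.c) * X.Sc w (u X.c) *
        (∏ b ∈ X.Bf, X.Fb b (u b) (u X.c)) * X.K g u) =
        pw X.mPV u * (X.Aα (u X.b₂) (u X.c) * D11 (u X.c) * X.Sc w (u X.c) *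
        (∏ b ∈ X.Bf, X.Fb b (u b) (u X.c)) * X.Gt g (readB (X.φ (u X.b₂)) (X.oc 0) u)
          (readB (X.φ (u X.b₂)) (X.oc 1) u) (readB (X.φ (u X.b₂)) (X.oc 2) u)) := fun u => by
      rw [X.K_eq_Gt hg u]
    rw [Finset.sum_congr rfl fun u _ => e1 u,
      inner_sum_eq X.mPV X.mPV_sum X.b₂ X.c X.b₂_ne_c.symm X.Bf hb₂ hc (X.oc 0) (X.oc 1) (X.oc 2) h01 h02 h12
        X.oc_hoW X.Aα D11 (X.Sc w) X.Fb X.φ (X.Gt g)]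
    refine Finset.sum_congr rfl fun α _ => Finset.sum_congr rfl fun γ _ => ?_
    rw [X.sum_reads_eq_cps g α]
    rfl
  rw [eM, eR, X.E_eq hg]
  have tab := dominance_checkRoot11 X.b2p_mem (X.slotOf w (X.obR 0)) (X.slotOf w (X.obR 1)) (X.slotOf w (X.obR 2))
    (fun y => X.Gt g y.1 y.2.1 y.2.2) (monotone_comp_xOf hg _ _ _)
  dsimp only at tab
  simp_rw [X.lawN_cast_root w] at tab
  have hF1 : ∑ y : Bool × Bool × Bool, 10 ^ 30 * X.ZR w *
      ∑ α, ∑ γ, X.ΦR w α γ * (X.cps 0 α y.1 * X.cps 1 α y.2.1 * X.cps 2 α y.2.2) =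
      10 ^ 30 * X.ZR w * ∑ α, ∑ γ, X.ΦR w α γ := by
    rw [← Finset.mul_sum, Finset.sum_comm]
    congr 1
    refine Finset.sum_congr rfl fun α _ => ?_
    rw [Finset.sum_comm]
    refine Finset.sum_congr rfl fun γ _ => ?_
    rw [← Finset.mul_sum, X.sum_cps_prod α, mul_one]
  have hF2 : ∑ y : Bool × Bool × Bool, 10 ^ 30 * X.ZR w *
      (∑ α, ∑ γ, X.ΦR w α γ * (X.cps 0 α y.1 * X.cps 1 α y.2.1 * X.cps 2 α y.2.2)) * X.Gt g y.1 y.2.1 y.2.2 =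
      10 ^ 30 * X.ZR w * ∑ α, ∑ γ, X.ΦR w α γ *
        ∑ y0, ∑ y1, ∑ y2, X.cps 0 α y0 * X.cps 1 α y1 * X.cps 2 α y2 * X.Gt g y0 y1 y2 := by
    have e : ∀ y : Bool × Bool × Bool, 10 ^ 30 * X.ZR w *
        (∑ α, ∑ γ, X.ΦR w α γ * (X.cps 0 α y.1 * X.cps 1 α y.2.1 * X.cps 2 α y.2.2)) * X.Gt g y.1 y.2.1 y.2.2 =
        10 ^ 30 * X.ZR w * ∑ α, ∑ γ, X.ΦR w α γ *
          (X.cps 0 α y.1 * X.cps 1 α y.2.1 * X.cps 2 α y.2.2 * X.Gt g y.1 y.2.1 y.2.2) := by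
      intro y
      rw [mul_assoc, Finset.sum_mul]
      congr 1
      refine Finset.sum_congr rfl fun α _ => ?_
      rw [Finset.sum_mul]
      exact Finset.sum_congr rfl fun γ _ => by ring
    simp_rw [e]
    rw [← Finset.mul_sum, Finset.sum_comm]
    congr 1
    refine Finset.sum_congr rfl fun α _ => ?_
    rw [Finset.sum_comm]
    refine Finset.sum_congr rfl fun γ _ => ?_
    rw [← Finset.mul_sum, Fintype.sum_prod_type]
    congr 1
    refine Finset.sum_congr rfl fun y0 _ => ?_
    rw [Fintype.sum_prod_type]
  rw [hF1, hF2, mul_assoc] at tab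
  exact le_of_mul_le_mul_left tab (by have := X.ZR_pos w; positivity)

end StepCtx

end VdBEMarkov

end Summit.CriticalPhenomena.PercolationContinuityZ3.Theorems.Pcint
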